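import Summits.MatrixMultiplication.OmegaCensus.DominoPartFiveZ4Z4
import HarnessLib

/-!
# The cube-law cells with parts `1` and `5` over `A ↠ ℤ₄ × ℤ₄`: `(1,5,33)` at `496`, `(1,5,49)` at `736`, `(1,5,65)` at `976`

ω-census `pub-omega`, family (b3), seat pub-omega-group gen 16.  Framing: lottery ticket; floor = certified bounds/negative
ranges.  VALUE: kernel theorems about the group-theoretic method (TPP capacity of dihedral-like groups) closing census
cells; NOT progress on ω.

Gen 15's `no_law_cube_15e_of_onto_z4z4` / `no_law_cube_1d5_of_onto_z4z4` (`DominoPartFiveZ4Z4.lean`) exclude every TPP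
triple of a dihedral-like group over `A ↠ ℤ₄²` (any `c₀`) whose coset parts have sizes `(1,1 | 5,5 | e,e)` resp.
`(1,1 | d,d | 5,5)` and which attains the law `3|S||T||U| + 8 = 8|A|`.  Here:

* `no_law_cube_one_five_of_onto_z4z4` — the CELL form: balanced parts (`|S₀| = |S₁|`, `|T₀| = |T₁|`, `|U₀| = |U₁|`), some
  `ρ`-part of size `1` and some `ρ`-part of size `5`, IN ANY POSITIONS (the six arrangements are reached by rotating the
  triple); then the law is not attained.
* Instances (census row NR133 cells, hitherto exact ×1 by gen 14's projected-identity solver): **`z4_z4_z31_no_law_cube_one_five`**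
  (`|A| = 496 = 3·165 + 1`, cell `(1,5,33)`), **`z4_z8_z23_no_law_cube_one_five`** (`736 = 3·245 + 1`, cell `(1,5,49)`),
  **`z4_z4_z61_no_law_cube_one_five`** (`976 = 3·325 + 1`, cell `(1,5,65)`).  These close the named cells only: at these
  orders the factorisations `(1,11,15)`, `(3,5,11)` (`496`), `(1,7,35)`, `(5,7,7)` (`736`), `(1,13,25)`, `(5,5,13)` (`976`)
  are other cube shapes not addressed here (the `(1,3,e)` cells at `496` are kernel by gen 14's `no_law_cube_13e_of_onto_z4z4`).
-/

namespace Summit.MatrixMultiplication.OmegaCensus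

open Finset

/-! ## The cell form over any `A ↠ ℤ₄²` -/

section DihedralLike

variable {A : Type} [AddCommGroup A] [DecidableEq A] [Fintype A] {G : Type} [Group G] [DecidableEq G]
  {ρ τ : A → G} {c₀ : A} {S T U : Finset G}

open Literature.Combinatorics.Additive

/-- **No cube law triple with parts `1` and `5` over `A ↠ ℤ₄ × ℤ₄`.**  Dihedral-like `G` over `A` (any `c₀`),
`φ : A →+ ZMod 4 × ZMod 4` onto; a TPP triple with balanced coset parts, one `ρ`-part of size `1` and one of size `5` (in any
of the three members).  Then `3|S||T||U| + 8 ≠ 8|A|`. [folklore] -/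
theorem no_law_cube_one_five_of_onto_z4z4
    (hρρ : ∀ a b, ρ a * ρ b = ρ (a + b)) (hρτ : ∀ a b, ρ a * τ b = τ (b - a))
    (hτρ : ∀ a b, τ a * ρ b = τ (a + b)) (hττ : ∀ a b, τ a * τ b = ρ (c₀ + b - a))
    (hρ : Function.Injective ρ) (hτ : Function.Injective τ) (hne : ∀ a b, ρ a ≠ τ b)
    (hsurj : ∀ g, (∃ a, ρ a = g) ∨ (∃ a, τ a = g))
    (φ : A →+ ZMod 4 × ZMod 4) (hφ : Function.Surjective φ)
    (h : TripleProductProperty S T U)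
    (hS : (univ.filter fun a : A => ρ a ∈ S).card = (univ.filter fun a : A => τ a ∈ S).card)
    (hT : (univ.filter fun a : A => ρ a ∈ T).card = (univ.filter fun a : A => τ a ∈ T).card)
    (hU : (univ.filter fun a : A => ρ a ∈ U).card = (univ.filter fun a : A => τ a ∈ U).card)
    (h1 : (univ.filter fun a : A => ρ a ∈ S).card = 1 ∨ (univ.filter fun a : A => ρ a ∈ T).card = 1 ∨
      (univ.filter fun a : A => ρ a ∈ U).card = 1)
    (h5 : (univ.filter fun a : A => ρ a ∈ S).card = 5 ∨ (univ.filter fun a : A => ρ a ∈ T).card = 5 ∨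
      (univ.filter fun a : A => ρ a ∈ U).card = 5) :
    3 * (S.card * T.card * U.card) + 8 ≠ 8 * Fintype.card A := by
  intro hV
  have hV_TUS : 3 * (T.card * U.card * S.card) + 8 = 8 * Fintype.card A := by
    rw [show T.card * U.card * S.card = S.card * T.card * U.card by ring]; exact hV
  have hV_UST : 3 * (U.card * S.card * T.card) + 8 = 8 * Fintype.card A := by
    rw [show U.card * S.card * T.card = S.card * T.card * U.card by ring]; exact hV
  have hTUS : TripleProductProperty T U S := h.rotate
  have hUST : TripleProductProperty U S T := h.rotate.rotate
  rcases h1 with hs1 | ht1 | hu1 <;> rcases h5 with hs5 | ht5 | hu5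
  · omega
  · exact no_law_cube_15e_of_onto_z4z4 hρρ hρτ hτρ hττ hρ hτ hne hsurj φ hφ h hs1 (hS ▸ hs1) ht5 (hT ▸ ht5) hU hV
  · exact no_law_cube_1d5_of_onto_z4z4 hρρ hρτ hτρ hττ hρ hτ hne hsurj φ hφ h hs1 (hS ▸ hs1) hT hu5 (hU ▸ hu5) hV
  · exact no_law_cube_1d5_of_onto_z4z4 hρρ hρτ hτρ hττ hρ hτ hne hsurj φ hφ hTUS ht1 (hT ▸ ht1) hU hs5 (hS ▸ hs5)
      hV_TUS
  · omega
  · exact no_law_cube_15e_of_onto_z4z4 hρρ hρτ hτρ hττ hρ hτ hne hsurj φ hφ hTUS ht1 (hT ▸ ht1) hu5 (hU ▸ hu5) hS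
      hV_TUS
  · exact no_law_cube_15e_of_onto_z4z4 hρρ hρτ hτρ hττ hρ hτ hne hsurj φ hφ hUST hu1 (hU ▸ hu1) hs5 (hS ▸ hs5) hT
      hV_UST
  · exact no_law_cube_1d5_of_onto_z4z4 hρρ hρτ hτρ hττ hρ hτ hne hsurj φ hφ hUST hu1 (hU ▸ hu1) hS ht5 (hT ▸ ht5)
      hV_UST
  · omega

end DihedralLike

/-! ## Instances: the three NR133 cells -/

section Instances

variable {G : Type} [Group G] [DecidableEq G] {S T U : Finset G}

open Literature.Combinatorics.Additive

/-- The projection `ℤ₄ × ℤ₄ × ℤ_n ↠ ℤ₄ × ℤ₄` (forget the last factor). [folklore] -/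
theorem z4_z4_zn_onto_z4z4 (n : ℕ) [NeZero n] : Function.Surjective
    ((AddMonoidHom.id (ZMod 4)).prodMap (AddMonoidHom.fst (ZMod 4) (ZMod n)) :
      ZMod 4 × (ZMod 4 × ZMod n) →+ ZMod 4 × ZMod 4) := by
  intro q
  exact ⟨(q.1, (q.2, 0)), Prod.ext rfl rfl⟩

/-- The reduction `ℤ₄ × ℤ₈ × ℤ_n ↠ ℤ₄ × ℤ₄` (identity, reduction mod `4`, forget). [folklore] -/
theorem z4_z8_zn_onto_z4z4 (n : ℕ) [NeZero n] : Function.Surjective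
    ((AddMonoidHom.id (ZMod 4)).prodMap
      ((ZMod.castHom (show 4 ∣ 8 by norm_num) (ZMod 4)).toAddMonoidHom.comp (AddMonoidHom.fst (ZMod 8) (ZMod n))) :
      ZMod 4 × (ZMod 8 × ZMod n) →+ ZMod 4 × ZMod 4) := by
  intro q
  obtain ⟨b, hb⟩ := ZMod.castHom_surjective (show 4 ∣ 8 by norm_num) (n := 8) q.2
  exact ⟨(q.1, (b, 0)), Prod.ext rfl hb⟩

/-- **Cell `(1,5,33)` at `|A| = 496`, `A = ℤ₄ × ℤ₄ × ℤ₃₁`**: no dihedral-like group over `A` (any `c₀`; `c₀ = 0` is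
`Dih(A)`) has a TPP triple with balanced coset parts, a part `1` and a part `5`, attaining `3|S||T||U| + 8 = 8·496`.
[folklore] -/
theorem z4_z4_z31_no_law_cube_one_five {ρ τ : ZMod 4 × (ZMod 4 × ZMod 31) → G} {c₀ : ZMod 4 × (ZMod 4 × ZMod 31)}
    (hρρ : ∀ a b, ρ a * ρ b = ρ (a + b)) (hρτ : ∀ a b, ρ a * τ b = τ (b - a))
    (hτρ : ∀ a b, τ a * ρ b = τ (a + b)) (hττ : ∀ a b, τ a * τ b = ρ (c₀ + b - a))
    (hρ : Function.Injective ρ) (hτ : Function.Injective τ) (hne : ∀ a b, ρ a ≠ τ b)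
    (hsurj : ∀ g, (∃ a, ρ a = g) ∨ (∃ a, τ a = g)) (h : TripleProductProperty S T U)
    (hS : (univ.filter fun a => ρ a ∈ S).card = (univ.filter fun a => τ a ∈ S).card)
    (hT : (univ.filter fun a => ρ a ∈ T).card = (univ.filter fun a => τ a ∈ T).card)
    (hU : (univ.filter fun a => ρ a ∈ U).card = (univ.filter fun a => τ a ∈ U).card)
    (h1 : (univ.filter fun a => ρ a ∈ S).card = 1 ∨ (univ.filter fun a => ρ a ∈ T).card = 1 ∨
      (univ.filter fun a => ρ a ∈ U).card = 1)
    (h5 : (univ.filter fun a => ρ a ∈ S).card = 5 ∨ (univ.filter fun a => ρ a ∈ T).card = 5 ∨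
      (univ.filter fun a => ρ a ∈ U).card = 5) :
    3 * (S.card * T.card * U.card) + 8 ≠ 8 * Fintype.card (ZMod 4 × (ZMod 4 × ZMod 31)) :=
  no_law_cube_one_five_of_onto_z4z4 hρρ hρτ hτρ hττ hρ hτ hne hsurj _ (z4_z4_zn_onto_z4z4 31) h hS hT hU h1 h5

/-- **Cell `(1,5,49)` at `|A| = 736`, `A = ℤ₄ × ℤ₈ × ℤ₂₃`**: no dihedral-like group over `A` (any `c₀`) has a TPP triple with
balanced coset parts, a part `1` and a part `5`, attaining `3|S||T||U| + 8 = 8·736`. [folklore] -/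
theorem z4_z8_z23_no_law_cube_one_five {ρ τ : ZMod 4 × (ZMod 8 × ZMod 23) → G} {c₀ : ZMod 4 × (ZMod 8 × ZMod 23)}
    (hρρ : ∀ a b, ρ a * ρ b = ρ (a + b)) (hρτ : ∀ a b, ρ a * τ b = τ (b - a))
    (hτρ : ∀ a b, τ a * ρ b = τ (a + b)) (hττ : ∀ a b, τ a * τ b = ρ (c₀ + b - a))
    (hρ : Function.Injective ρ) (hτ : Function.Injective τ) (hne : ∀ a b, ρ a ≠ τ b)
    (hsurj : ∀ g, (∃ a, ρ a = g) ∨ (∃ a, τ a = g)) (h : TripleProductProperty S T U)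
    (hS : (univ.filter fun a => ρ a ∈ S).card = (univ.filter fun a => τ a ∈ S).card)
    (hT : (univ.filter fun a => ρ a ∈ T).card = (univ.filter fun a => τ a ∈ T).card)
    (hU : (univ.filter fun a => ρ a ∈ U).card = (univ.filter fun a => τ a ∈ U).card)
    (h1 : (univ.filter fun a => ρ a ∈ S).card = 1 ∨ (univ.filter fun a => ρ a ∈ T).card = 1 ∨
      (univ.filter fun a => ρ a ∈ U).card = 1)
    (h5 : (univ.filter fun a => ρ a ∈ S).card = 5 ∨ (univ.filter fun a => ρ a ∈ T).card = 5 ∨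
      (univ.filter fun a => ρ a ∈ U).card = 5) :
    3 * (S.card * T.card * U.card) + 8 ≠ 8 * Fintype.card (ZMod 4 × (ZMod 8 × ZMod 23)) :=
  no_law_cube_one_five_of_onto_z4z4 hρρ hρτ hτρ hττ hρ hτ hne hsurj _ (z4_z8_zn_onto_z4z4 23) h hS hT hU h1 h5

/-- **Cell `(1,5,65)` at `|A| = 976`, `A = ℤ₄ × ℤ₄ × ℤ₆₁`**: no dihedral-like group over `A` (any `c₀`) has a TPP triple with
balanced coset parts, a part `1` and a part `5`, attaining `3|S||T||U| + 8 = 8·976`. [folklore] -/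
theorem z4_z4_z61_no_law_cube_one_five {ρ τ : ZMod 4 × (ZMod 4 × ZMod 61) → G} {c₀ : ZMod 4 × (ZMod 4 × ZMod 61)}
    (hρρ : ∀ a b, ρ a * ρ b = ρ (a + b)) (hρτ : ∀ a b, ρ a * τ b = τ (b - a))
    (hτρ : ∀ a b, τ a * ρ b = τ (a + b)) (hττ : ∀ a b, τ a * τ b = ρ (c₀ + b - a))
    (hρ : Function.Injective ρ) (hτ : Function.Injective τ) (hne : ∀ a b, ρ a ≠ τ b)
    (hsurj : ∀ g, (∃ a, ρ a = g) ∨ (∃ a, τ a = g)) (h : TripleProductProperty S T U)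
    (hS : (univ.filter fun a => ρ a ∈ S).card = (univ.filter fun a => τ a ∈ S).card)
    (hT : (univ.filter fun a => ρ a ∈ T).card = (univ.filter fun a => τ a ∈ T).card)
    (hU : (univ.filter fun a => ρ a ∈ U).card = (univ.filter fun a => τ a ∈ U).card)
    (h1 : (univ.filter fun a => ρ a ∈ S).card = 1 ∨ (univ.filter fun a => ρ a ∈ T).card = 1 ∨
      (univ.filter fun a => ρ a ∈ U).card = 1)
    (h5 : (univ.filter fun a => ρ a ∈ S).card = 5 ∨ (univ.filter fun a => ρ a ∈ T).card = 5 ∨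
      (univ.filter fun a => ρ a ∈ U).card = 5) :
    3 * (S.card * T.card * U.card) + 8 ≠ 8 * Fintype.card (ZMod 4 × (ZMod 4 × ZMod 61)) :=
  no_law_cube_one_five_of_onto_z4z4 hρρ hρτ hτρ hττ hρ hτ hne hsurj _ (z4_z4_zn_onto_z4z4 61) h hS hT hU h1 h5

end Instances

end Summit.MatrixMultiplication.OmegaCensus
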